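import Summits.FinalStateConjecture.FinalStateConjecture.Theorems.ClusterCompletenessAdiabaticMultiKerrILEDRadialWaveOperator
import Summits.FinalStateConjecture.FinalStateConjecture.Theorems.ClusterCompletenessAdiabaticMultiKerrILEDQuadraticDecomposition
import Summits.FinalStateConjecture.FinalStateConjecture.Theorems.ClusterCompletenessAdiabaticMultiKerrILEDMorawetzCoefficients
import Summits.FinalStateConjecture.FinalStateConjecture.Theorems.ClusterCompletenessAdiabaticMultiKerrILEDMorawetzCoefficientsLower
import Summits.FinalStateConjecture.FinalStateConjecture.Theorems.ClusterCompletenessAdiabaticMultiKerrILEDMorawetzWeight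
import Summits.FinalStateConjecture.FinalStateConjecture.Theorems.ClusterCompletenessAdiabaticMultiKerrILEDRiccatiCertificateTheta
import Literature.NumberTheory.Sieve.GreenTao2008PseudorandomMajorantProofs

/-!
# Crux `AdiabaticMultiKerrILED` (line `Sketch`) — pointwise positivity of the Morawetz bulk

Helper file for the crux `stmt-FinalStateConjecture-14310`
(`Summit.FinalStateConjecture.FinalStateConjecture.Theses.ClusterCompleteness.AdiabaticMultiKerrILED`),
line `Sketch`, stub `morawetz_totalBulk_lower` (lead c7, wave 5, Morawetz integration).

Rest-frame zero-spin tails-cut zone `G₀ = η⁻¹ − μ ℓ♯ ⊗ ℓ♯`, `μ = χ(r)·2M/r`, `χ(r) = σ(2 − r/(8M))`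
(`σ = Real.smoothTransition`), `f = 1 − μ`, `r = Kerr.radius 0 x`. The bulk of the total Morawetz current
`J^X + ¼L^{ϖ₂} + J_H` (`X = (1 − 3M/r)∂_{r*}`, `ϖ₂ = 2ϖ`, `ϖ(s) = (1 − 2M/s)((2s − 3M)/s² − M³(s − 3M)²/s⁶)`,
Hardy weight `ŷ(s) = 2(7M − s)²q_θ(s/M)/(M³s)` on `s ≤ 7M`, `0` beyond) is
`K^X + ¼ϖ₂G₀(dΦ,dΦ) − ⅛(□ϖ₂)Φ² + ŷΦ∂_{r*}Φ + ½Φ²r⁻²(r²fŷ)′`; `morawetz_totalBulk_lower` proves it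
dominates `𝔅 = (r−2M)M³(r−3M)²/(2r⁷)(∂₀Φ)² + 3M/(20r²)(∂_{r*}Φ)² + (r−3M)²/(8r³)|∇̸Φ|² + 𝟙_{r≥7M}M(r−7M)/(4r⁵)Φ²`
wherever `r > 2M`. The bricks `multiplierBulk_radial_tailsCut`, `inverseMetric_quadratic_decomposition_tailsCut`,
`waveOperator_radial_tailsCut` turn the bulk into `A_T(∂₀Φ)² + A_R(∂_{r*}Φ)² + A_ang|∇̸Φ|² + PΦ² + (Hardy)`
(`morawetzBulk_master`, pure real algebra); `A_T`, `A_R ≥ M/r²`, `A_ang` come from `…MorawetzCoefficients(Lower)`;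
for `r ≥ 7M` the Hardy terms vanish and `P ≥ M(r−7M)/(4r⁵)` (`morawetzBulk_outer_zeroth_lower`); for
`2M < r < 7M` the zone is exact Schwarzschild and `(17/20)A_R D² + ŷΦD + (P + ½r⁻²(r²fŷ)′)Φ² ≥ 0` is, after
completing the square, `riccati_certificate_theta` at `ρ = r/M` (`morawetzBulk_inner_nonneg`).
Dafermos–Rodnianski arXiv:0811.0354, §4.1.1 (the `X`-estimate with Hardy correction). [folklore]
-/

noncomputable section

-- the doubled `FinalStateConjecture.FinalStateConjecture` path component trips dupNamespace
set_option linter.dupNamespace false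

open scoped Topology BigOperators
open Filter Set Literature.Geometry.Lorentzian

namespace Summit.FinalStateConjecture.FinalStateConjecture.Theorems

/-! ### Real-variable bricks -/

/-- **Inner region `2M < r < 7M` (exact Schwarzschild, `χ = 1`, `χ′ = 0`): the Hardy-corrected radial /
zeroth-order form `aD² + bφD + cφ²` is nonnegative**, `a = (17/20)A_R > 0` (`morawetz_radialCoeff_pos`),
`b = ŷ(r)`, `c = P + ½r⁻²·2y′(r/M)/M`: indeed `4ac − b² = 4/(r⁴f²)·Cert(r/M)` (`f = 1 − 2M/r`,
`field_simp; ring`) with `Cert ≥ 0` exactly `riccati_certificate_theta`. [folklore] -/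
theorem morawetzBulk_inner_nonneg (M r χ d D φ : ℝ) (hM : 0 < M) (h2 : 2 * M < r) (h7 : r < 7 * M)
    (hχ : χ = 1) (hd : d = 0) :
    0 ≤ 17 / 20 * (((1 - 2 * M * χ / r) * (3 * M / r ^ 2) - 2 * (1 - 2 * M * χ / r) * (1 - 3 * M / r) / r +
        (fun s : ℝ ↦ (1 - 2 * M / s) * ((2 * s - 3 * M) / s ^ 2 - M ^ 3 * (s - 3 * M) ^ 2 / s ^ 6)) r) / (2 * (1 - 2 * M * χ / r))) * D ^ 2 +
      2 * (7 * M - r) ^ 2 * (-(593459 / 10000000) + 788874 / 10000000 * (r / M) -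
        383061 / 10000000 * (r / M) ^ 2 + 92031 / 10000000 * (r / M) ^ 3 - 10985 / 10000000 * (r / M) ^ 4 +
        525 / 10000000 * (r / M) ^ 5) / (M ^ 3 * r) * φ * D +
      (-(4⁻¹ * ((1 - 2 * M * χ / r) * (r⁻¹ ^ 2 * ((-14 * M * r ^ 5 + 36 * M ^ 2 * r ^ 4 - 12 * M ^ 3 * r ^ 3 + 160 * M ^ 4 * r ^ 2 - 630 * M ^ 5 * r + 756 * M ^ 6) / r ^ 7)) +
          (2 * M * χ / r ^ 2 - 2 * M * (d * -(1 / (8 * M))) / r) * ((-2 * r ^ 6 + 14 * M * r ^ 5 - 18 * M ^ 2 * r ^ 4 + 4 * M ^ 3 * r ^ 3 - 40 * M ^ 4 * r ^ 2 + 126 * M ^ 5 * r - 126 * M ^ 6) / r ^ 8))) +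
        2⁻¹ * (r⁻¹ ^ 2 * (2 * (((21 : ℝ) / 50000 * (r / M) ^ 7 + (-((27139 : ℝ) / 2000000)) * (r / M) ^ 6 +
        (115581 : ℝ) / 625000 * (r / M) ^ 5 + (-((688213 : ℝ) / 500000)) * (r / M) ^ 4 +
        (15080767 : ℝ) / 2500000 * (r / M) ^ 3 + (-((77595267 : ℝ) / 5000000)) * (r / M) ^ 2 +
        (5388931 : ℝ) / 250000 * (r / M) ^ 1 + (-((24601199 : ℝ) / 2000000))) * (1 / M))))) * φ ^ 2 := by
  subst hχ hd
  have hr : 0 < r := by linarith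
  have hr0 : r ≠ 0 := hr.ne'
  have hM0 : M ≠ 0 := hM.ne'
  have hf : r - 2 * M ≠ 0 := by
    intro h
    linarith
  have hf' : 1 - 2 * M / r ≠ 0 := by
    rw [sub_ne_zero, ne_comm, ne_eq, div_eq_one_iff_eq hr0]
    intro h
    linarith
  have hf'' : 1 - 2 * M * 1 / r ≠ 0 := by
    rw [mul_one]
    exact hf'
  -- completing the square, for abstract coefficients
  have key : ∀ A B C T : ℝ, 0 ≤ T → M / r ^ 2 ≤ A →
      4 * (17 / 20 * A) * C - B ^ 2 = 4 / (r ^ 4 * (1 - 2 * M / r) ^ 2) * T →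
      0 ≤ 17 / 20 * A * D ^ 2 + B * φ * D + C * φ ^ 2 := by
    intro A B C T hT hA hid
    have hA0 : 0 < 17 / 20 * A := by
      have : 0 < M / r ^ 2 := by positivity
      linarith
    have hdisc : 0 ≤ (4 * (17 / 20 * A) * C - B ^ 2) * φ ^ 2 := by
      rw [hid]
      exact mul_nonneg (mul_nonneg (by positivity) hT) (sq_nonneg φ)
    refine le_of_mul_le_mul_left ?_ hA0
    rw [mul_zero, show 17 / 20 * A * (17 / 20 * A * D ^ 2 + B * φ * D + C * φ ^ 2) =
      (17 / 20 * A * D + B * φ / 2) ^ 2 + 4⁻¹ * ((4 * (17 / 20 * A) * C - B ^ 2) * φ ^ 2) by ring]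
    exact add_nonneg (sq_nonneg _) (mul_nonneg (by norm_num) hdisc)
  -- the certificate at `ρ = r/M ∈ (2, 7]`
  refine key _ _ _ _ (riccati_certificate_theta (r / M) (by rw [lt_div_iff₀ hM]; linarith)
    (by rw [div_le_iff₀ hM]; linarith)) (morawetz_radialCoeff_pos M r 1 hM h2 zero_le_one le_rfl) ?_
  field_simp
  ring

/-- `13r⁶ − 57Mr⁵ + 84M²r⁴ − 184M³r³ + 950M⁴r² − 2016M⁵r + 1512M⁶ ≥ 0` for `r ≥ 7M > 0`: after
`r = 7M + u` every coefficient is positive. [folklore] -/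
private theorem morawetzBulk_outerPoly_nonneg {M r : ℝ} (hM : 0 < M) (h7 : 7 * M ≤ r) :
    0 ≤ 13 * r ^ 6 - 57 * M * r ^ 5 + 84 * M ^ 2 * r ^ 4 - 184 * M ^ 3 * r ^ 3 + 950 * M ^ 4 * r ^ 2 -
      2016 * M ^ 5 * r + 1512 * M ^ 6 := by
  obtain ⟨u, hu, rfl⟩ : ∃ u : ℝ, 0 ≤ u ∧ r = 7 * M + u := ⟨r - 7 * M, sub_nonneg.2 h7, by ring⟩
  have h1 : 13 * (7 * M + u) ^ 6 - 57 * M * (7 * M + u) ^ 5 + 84 * M ^ 2 * (7 * M + u) ^ 4 -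
      184 * M ^ 3 * (7 * M + u) ^ 3 + 950 * M ^ 4 * (7 * M + u) ^ 2 - 2016 * M ^ 5 * (7 * M + u) + 1512 * M ^ 6 =
      743960 * M ^ 6 + 726145 * M ^ 5 * u + 294467 * M ^ 4 * u ^ 2 + 63418 * M ^ 3 * u ^ 3 +
        7644 * M ^ 2 * u ^ 4 + 489 * M * u ^ 5 + 13 * u ^ 6 := by
    ring
  rw [h1]
  positivity

/-- **Outer region `r ≥ 7M`: the zeroth-order coefficient `P = −¼[f r⁻²(s²ϖ′)′ + f_r ϖ′]` dominates
`M(r − 7M)/(4r⁵)`** (`f = 1 − 2Mχ/r`, `f_r = 2Mχ/r² + d/(4r)`, `χ ∈ [0, 1]`, `d ≥ 0`): with `w₁ = ϖ′ ≤ 0`,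
`w₂ = (s²ϖ′)′ ≤ 0` (`morawetzWeight_derivs_nonpos`), `4r⁵(P − M(r−7M)/(4r⁵))` is the sum of the
nonnegative `2Mr²(1 − χ)(−w₂)`, `2Mχr³(−w₁)`, `(dr⁴/4)(−w₁)` and
`−(r − 2M)r²w₂ − M(r − 7M) = M(13r⁶ − 57Mr⁵ + ⋯ + 1512M⁶)/r⁵ ≥ 0`. [folklore] -/
theorem morawetzBulk_outer_zeroth_lower (M r χ d : ℝ) (hM : 0 < M) (h7 : 7 * M ≤ r) (hχ0 : 0 ≤ χ)
    (hχ1 : χ ≤ 1) (hd0 : 0 ≤ d) :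
    M * (r - 7 * M) / (4 * r ^ 5) ≤
      -(4⁻¹ * ((1 - 2 * M * χ / r) * (r⁻¹ ^ 2 * ((-14 * M * r ^ 5 + 36 * M ^ 2 * r ^ 4 - 12 * M ^ 3 * r ^ 3 + 160 * M ^ 4 * r ^ 2 - 630 * M ^ 5 * r + 756 * M ^ 6) / r ^ 7)) +
          (2 * M * χ / r ^ 2 - 2 * M * (d * -(1 / (8 * M))) / r) * ((-2 * r ^ 6 + 14 * M * r ^ 5 - 18 * M ^ 2 * r ^ 4 + 4 * M ^ 3 * r ^ 3 - 40 * M ^ 4 * r ^ 2 + 126 * M ^ 5 * r - 126 * M ^ 6) / r ^ 8))) := by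
  have hr : 0 < r := by linarith
  have hr0 : r ≠ 0 := hr.ne'
  have hM0 : M ≠ 0 := hM.ne'
  have key : ∀ w₁ w₂ : ℝ, w₁ ≤ 0 → w₂ ≤ 0 → 0 ≤ -(r - 2 * M) * r ^ 2 * w₂ - M * (r - 7 * M) →
      M * (r - 7 * M) / (4 * r ^ 5) ≤
        -(4⁻¹ * ((1 - 2 * M * χ / r) * (r⁻¹ ^ 2 * w₂) + (2 * M * χ / r ^ 2 - 2 * M * (d * -(1 / (8 * M))) / r) * w₁)) := by
    intro w₁ w₂ hw1 hw2 hq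
    have t1 : 0 ≤ 2 * M * r ^ 2 * (1 - χ) * -w₂ :=
      mul_nonneg (mul_nonneg (by positivity) (sub_nonneg.2 hχ1)) (neg_nonneg.2 hw2)
    have t2 : 0 ≤ 2 * M * χ * r ^ 3 * -w₁ :=
      mul_nonneg (mul_nonneg (by positivity) (pow_nonneg hr.le 3)) (neg_nonneg.2 hw1)
    have t3 : 0 ≤ d * r ^ 4 / 4 * -w₁ := mul_nonneg (by positivity) (neg_nonneg.2 hw1)
    rw [← sub_nonneg, show -(4⁻¹ * ((1 - 2 * M * χ / r) * (r⁻¹ ^ 2 * w₂) + (2 * M * χ / r ^ 2 - 2 * M * (d * -(1 / (8 * M))) / r) * w₁)) -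
      M * (r - 7 * M) / (4 * r ^ 5) = ((-(r - 2 * M) * r ^ 2 * w₂ - M * (r - 7 * M)) +
      2 * M * r ^ 2 * (1 - χ) * -w₂ + 2 * M * χ * r ^ 3 * -w₁ + d * r ^ 4 / 4 * -w₁) / (4 * r ^ 5) by
      field_simp; ring]
    exact div_nonneg (by linarith) (by positivity)
  obtain ⟨hw1, hw2⟩ := morawetzWeight_derivs_nonpos M r hM (by linarith)
  refine key _ _ hw1 hw2 ((mul_nonneg_iff_of_pos_right (pow_pos hr 5)).mp ?_)
  convert mul_nonneg hM.le (morawetzBulk_outerPoly_nonneg hM h7) using 1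
  field_simp
  ring

/-- **The pointwise Morawetz inequality in real variables.** Atoms: the radius `r > 2M`; the value
`χ ∈ [0,1]` and slope `−d/(8M)` (`d ∈ [0, 2]`) of the cut-off at `r` (`χ = 1`, `d = 0` when `r < 8M`);
`p₀ = ∂₀Φ`, `D = ∂_{r*}Φ`, `g = |∇̸Φ|² ≥ 0`, `φ = Φ(x)`; the Hardy value `hv = ŷ(r)` and flux derivative
`hd = (s²fŷ)′(r)` (explicit for `r < 7M`, zero for `r ≥ 7M`). Then `𝔅 ≤ A_T p₀² + A_R D² + A_ang g + Pφ²
+ hv φ D + ½φ²r⁻²hd` by `morawetz_timeCoeff_lower`, `morawetz_radialCoeff_pos`,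
`morawetz_angularCoeff_lower_inner/outer`, and `morawetzBulk_inner_nonneg` (`r < 7M`) /
`morawetzBulk_outer_zeroth_lower` (`r ≥ 7M`). [folklore] -/
theorem morawetzBulk_master (M r χ d p₀ D g φ hv hd : ℝ) (hM : 0 < M) (h2 : 2 * M < r)
    (hχ0 : 0 ≤ χ) (hχ1 : χ ≤ 1) (hd0 : 0 ≤ d) (hd2 : d ≤ 2) (hin : r < 8 * M → χ = 1 ∧ d = 0) (hg : 0 ≤ g)
    (hH1 : r < 7 * M → hv = 2 * (7 * M - r) ^ 2 * (-(593459 / 10000000) + 788874 / 10000000 * (r / M) -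
        383061 / 10000000 * (r / M) ^ 2 + 92031 / 10000000 * (r / M) ^ 3 - 10985 / 10000000 * (r / M) ^ 4 +
        525 / 10000000 * (r / M) ^ 5) / (M ^ 3 * r) ∧
      hd = 2 * (((21 : ℝ) / 50000 * (r / M) ^ 7 + (-((27139 : ℝ) / 2000000)) * (r / M) ^ 6 +
        (115581 : ℝ) / 625000 * (r / M) ^ 5 + (-((688213 : ℝ) / 500000)) * (r / M) ^ 4 +
        (15080767 : ℝ) / 2500000 * (r / M) ^ 3 + (-((77595267 : ℝ) / 5000000)) * (r / M) ^ 2 +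
        (5388931 : ℝ) / 250000 * (r / M) ^ 1 + (-((24601199 : ℝ) / 2000000))) * (1 / M)))
    (hH2 : 7 * M ≤ r → hv = 0 ∧ hd = 0) :
    (r - 2 * M) * M ^ 3 * (r - 3 * M) ^ 2 / (2 * r ^ 7) * p₀ ^ 2 + 3 * M / (20 * r ^ 2) * D ^ 2 +
        (r - 3 * M) ^ 2 / (8 * r ^ 3) * g + (if 7 * M ≤ r then M * (r - 7 * M) / (4 * r ^ 5) else 0) * φ ^ 2 ≤
      ((1 - 2 * M * χ / r) * (3 * M / r ^ 2) + 2 * (1 - 2 * M * χ / r) * (1 - 3 * M / r) / r -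
        (fun s : ℝ ↦ (1 - 2 * M / s) * ((2 * s - 3 * M) / s ^ 2 - M ^ 3 * (s - 3 * M) ^ 2 / s ^ 6)) r) / (2 * (1 - 2 * M * χ / r)) * p₀ ^ 2 +
      ((1 - 2 * M * χ / r) * (3 * M / r ^ 2) - 2 * (1 - 2 * M * χ / r) * (1 - 3 * M / r) / r +
        (fun s : ℝ ↦ (1 - 2 * M / s) * ((2 * s - 3 * M) / s ^ 2 - M ^ 3 * (s - 3 * M) ^ 2 / s ^ 6)) r) / (2 * (1 - 2 * M * χ / r)) * D ^ 2 +
      2⁻¹ * (-(1 - 3 * M / r) * (2 * M * χ / r ^ 2 - 2 * M * (d * -(1 / (8 * M))) / r) -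
        (1 - 2 * M * χ / r) * (3 * M / r ^ 2) + (fun s : ℝ ↦ (1 - 2 * M / s) * ((2 * s - 3 * M) / s ^ 2 - M ^ 3 * (s - 3 * M) ^ 2 / s ^ 6)) r) * g +
      -(4⁻¹ * ((1 - 2 * M * χ / r) * (r⁻¹ ^ 2 * ((-14 * M * r ^ 5 + 36 * M ^ 2 * r ^ 4 - 12 * M ^ 3 * r ^ 3 + 160 * M ^ 4 * r ^ 2 - 630 * M ^ 5 * r + 756 * M ^ 6) / r ^ 7)) +
          (2 * M * χ / r ^ 2 - 2 * M * (d * -(1 / (8 * M))) / r) * ((-2 * r ^ 6 + 14 * M * r ^ 5 - 18 * M ^ 2 * r ^ 4 + 4 * M ^ 3 * r ^ 3 - 40 * M ^ 4 * r ^ 2 + 126 * M ^ 5 * r - 126 * M ^ 6) / r ^ 8))) * φ ^ 2 +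
      (hv * φ * D + 2⁻¹ * φ ^ 2 * (r⁻¹ ^ 2 * hd)) := by
  have hr : 0 < r := by linarith
  -- the slope `χd = −d/(8M) ∈ [−1/(4M), 0]`
  have hcd1 : d * -(1 / (8 * M)) ≤ 0 :=
    mul_nonpos_of_nonneg_of_nonpos hd0 (by rw [neg_nonpos]; positivity)
  have hcd0 : -(1 / (4 * M)) ≤ d * -(1 / (8 * M)) := by
    rw [show -(1 / (4 * M)) = 2 * -(1 / (8 * M)) by ring]
    exact mul_le_mul_of_nonpos_right hd2 (by rw [neg_nonpos]; positivity)
  -- the coefficient bounds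
  have h1 := mul_le_mul_of_nonneg_right (morawetz_timeCoeff_lower M r χ hM h2 hχ0 hχ1) (sq_nonneg p₀)
  have h2' := mul_le_mul_of_nonneg_right (morawetz_radialCoeff_pos M r χ hM h2 hχ0 hχ1) (sq_nonneg D)
  have hA := (le_or_gt (8 * M) r).elim
    (fun h8 ↦ morawetz_angularCoeff_lower_outer M r χ (d * -(1 / (8 * M))) hM h8 hχ0 hχ1 hcd0 hcd1)
    (fun h8 ↦ by
      obtain ⟨hχ, hdd⟩ := hin h8
      rw [hχ, hdd, zero_mul, mul_zero, zero_div, sub_zero, mul_one]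
      exact morawetz_angularCoeff_lower_inner M r hM h2)
  have h3 := mul_le_mul_of_nonneg_right hA hg
  have hMr : 0 ≤ M / r ^ 2 * D ^ 2 := by positivity
  rw [show 3 * M / (20 * r ^ 2) = 3 / 20 * (M / r ^ 2) by field_simp]
  rcases lt_or_ge r (7 * M) with h7 | h7
  · -- inner region: Hardy certificate
    obtain ⟨hχ, hdd⟩ := hin (by linarith)
    obtain ⟨rfl, rfl⟩ := hH1 h7
    rw [if_neg (not_le.mpr h7)]
    linarith [morawetzBulk_inner_nonneg M r χ d D φ hM h2 h7 hχ hdd]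
  · -- outer region: no Hardy term, positive zeroth-order coefficient
    obtain ⟨rfl, rfl⟩ := hH2 h7
    rw [if_pos h7]
    linarith [mul_le_mul_of_nonneg_right (morawetzBulk_outer_zeroth_lower M r χ d hM h7 hχ0 hχ1 hd0)
      (sq_nonneg φ)]

/-! ### Two calculus helpers for the Hardy weight beyond `7M` -/

/-- For `7M ≤ r ≤ s` the Hardy weight `𝟙_{s ≤ 7M} · 2(7M − s)² A/B` vanishes at `s` (either `s > 7M`,
or `s = 7M` where the double zero kills it). [folklore] -/
private theorem morawetzBulk_hardy_eq_zero {M r s A B : ℝ} (h7 : 7 * M ≤ r) (hs : r ≤ s) :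
    (if s ≤ 7 * M then 2 * (7 * M - s) ^ 2 * A / B else 0) = 0 := by
  split_ifs with h
  · rw [show 7 * M - s = 0 by linarith]
    simp
  · rfl

/-- A real function vanishing on `[r, ∞)` has `deriv F r = 0`: if `F` is differentiable at `r`, its
derivative is the derivative within `Ici r`, where `F` agrees with the constant `0`
(`uniqueDiffWithinAt_Ici`); otherwise `deriv F r = 0` by definition. [folklore] -/
private theorem morawetzBulk_deriv_eq_zero {F : ℝ → ℝ} {r : ℝ} (h : ∀ s, r ≤ s → F s = 0) :
    deriv F r = 0 := by
  by_cases hF : DifferentiableAt ℝ F r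
  · exact (uniqueDiffWithinAt_Ici r).eq_deriv _ hF.hasDerivAt.hasDerivWithinAt
      ((hasDerivWithinAt_const r _ (0 : ℝ)).congr_of_mem (fun s hs ↦ h s hs) Set.self_mem_Ici)
  · exact deriv_zero_of_not_differentiableAt hF

/-! ### The registered stub -/

/-- **Stub `morawetz_totalBulk_lower`** (crux `AdiabaticMultiKerrILED`, line `Sketch`): at every point
with `r > 2M` the bulk `K^X + ¼ϖ₂G₀(dΦ,dΦ) − ⅛(□_{G₀}ϖ₂)Φ² + ŷΦ∂_{r*}Φ + ½Φ²r⁻²(r²fŷ)′` of the total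
Morawetz current of the rest-frame zero-spin tails-cut zone dominates
`𝔅 = (r−2M)M³(r−3M)²/(2r⁷)(∂₀Φ)² + 3M/(20r²)(∂_{r*}Φ)² + (r−3M)²/(8r³)|∇̸Φ|² + 𝟙_{r ≥ 7M}M(r−7M)/(4r⁵)Φ²`.
Proof: rewrite with `multiplierBulk_radial_tailsCut` (`F = 1 − 3M/s`),
`inverseMetric_quadratic_decomposition_tailsCut` and `waveOperator_radial_tailsCut` (`u = ϖ₂`; flux
derivative via `hasDerivAt_morawetzWeight`, `hasDerivAt_sq_mul_morawetzWeightDeriv`), compute the Hardy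
value and flux derivative (`r < 7M`: `s²fŷ = 2y(s/M)` is a polynomial near `r`; `r ≥ 7M`: `ŷ` vanishes on
`[r, ∞)`), and apply `morawetzBulk_master`; the final regrouping is `field_simp; ring` on opaque atoms.
Dafermos–Rodnianski arXiv:0811.0354, §4.1.1. [folklore] -/
theorem morawetz_totalBulk_lower : ∀ (M : ℝ) (Φ : E4 → ℝ) (x : E4), 0 < M → 2 * M < Kerr.radius 0 x →
    (((Kerr.radius 0 x - 2 * M) * M ^ 3 * (Kerr.radius 0 x - 3 * M) ^ 2 / (2 * Kerr.radius 0 x ^ 7)) * fderiv ℝ Φ x (E4.basisVector 0) ^ 2 +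
        (3 * M / (20 * Kerr.radius 0 x ^ 2)) * ((1 - (Real.smoothTransition (2 - Kerr.radius 0 x / (8 * M)) * (2 * Kerr.scalarH M 0 x))) * (∑ i : Fin 3, x i.succ * fderiv ℝ Φ x (E4.basisVector i.succ)) / Kerr.radius 0 x + (Real.smoothTransition (2 - Kerr.radius 0 x / (8 * M)) * (2 * Kerr.scalarH M 0 x)) * fderiv ℝ Φ x (E4.basisVector 0)) ^ 2 +
        ((Kerr.radius 0 x - 3 * M) ^ 2 / (8 * Kerr.radius 0 x ^ 3)) * ((∑ i : Fin 3, fderiv ℝ Φ x (E4.basisVector i.succ) ^ 2) - ((∑ i : Fin 3, x i.succ * fderiv ℝ Φ x (E4.basisVector i.succ)) / Kerr.radius 0 x) ^ 2) +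
        (if 7 * M ≤ Kerr.radius 0 x then M * (Kerr.radius 0 x - 7 * M) / (4 * Kerr.radius 0 x ^ 5) else 0) * Φ x ^ 2) ≤
      (KerrSchild.multiplierBulk (KerrSchild.inverseMetric (fun y ↦ Real.smoothTransition (2 - Kerr.radius 0 y / (8 * M)) * (2 * Kerr.scalarH M 0 y)) (Kerr.nullVector 0)) (fun (z : E4) (α : Fin 4) ↦ if α = 0 then (1 - 3 * M / Kerr.radius 0 z) * (Real.smoothTransition (2 - Kerr.radius 0 z / (8 * M)) * (2 * Kerr.scalarH M 0 z))
          else (1 - 3 * M / Kerr.radius 0 z) * (1 - (Real.smoothTransition (2 - Kerr.radius 0 z / (8 * M)) * (2 * Kerr.scalarH M 0 z))) * z α / Kerr.radius 0 z) Φ x +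
        4⁻¹ * ((fun s ↦ 2 * ((1 - 2 * M / s) * ((2 * s - 3 * M) / s ^ 2 - M ^ 3 * (s - 3 * M) ^ 2 / s ^ 6))) (Kerr.radius 0 x) * (∑ μ, ∑ ν, (KerrSchild.inverseMetric (fun y ↦ Real.smoothTransition (2 - Kerr.radius 0 y / (8 * M)) * (2 * Kerr.scalarH M 0 y)) (Kerr.nullVector 0)) x μ ν * fderiv ℝ Φ x (E4.basisVector μ) * fderiv ℝ Φ x (E4.basisVector ν))) -
        8⁻¹ * KerrSchild.waveOperator (KerrSchild.inverseMetric (fun y ↦ Real.smoothTransition (2 - Kerr.radius 0 y / (8 * M)) * (2 * Kerr.scalarH M 0 y)) (Kerr.nullVector 0)) (fun y ↦ (fun s ↦ 2 * ((1 - 2 * M / s) * ((2 * s - 3 * M) / s ^ 2 - M ^ 3 * (s - 3 * M) ^ 2 / s ^ 6))) (Kerr.radius 0 y)) x * Φ x ^ 2 +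
        ((fun s ↦ if s ≤ 7 * M then 2 * (7 * M - s) ^ 2 * (fun ρ ↦ (-((593459 : ℝ) / 10000000)) + (788874 : ℝ) / 10000000 * ρ - (383061 : ℝ) / 10000000 * ρ ^ 2 + (92031 : ℝ) / 10000000 * ρ ^ 3 - (10985 : ℝ) / 10000000 * ρ ^ 4 + (525 : ℝ) / 10000000 * ρ ^ 5) (s / M) / (M ^ 3 * s) else 0) (Kerr.radius 0 x) * Φ x * ((1 - (Real.smoothTransition (2 - Kerr.radius 0 x / (8 * M)) * (2 * Kerr.scalarH M 0 x))) * (∑ i : Fin 3, x i.succ * fderiv ℝ Φ x (E4.basisVector i.succ)) / Kerr.radius 0 x + (Real.smoothTransition (2 - Kerr.radius 0 x / (8 * M)) * (2 * Kerr.scalarH M 0 x)) * fderiv ℝ Φ x (E4.basisVector 0)) +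
          2⁻¹ * Φ x ^ 2 * ((Kerr.radius 0 x)⁻¹ ^ 2 * deriv (fun s ↦ s ^ 2 * (fun s ↦ 1 - Real.smoothTransition (2 - s / (8 * M)) * (2 * M / s)) s * (fun s ↦ if s ≤ 7 * M then 2 * (7 * M - s) ^ 2 * (fun ρ ↦ (-((593459 : ℝ) / 10000000)) + (788874 : ℝ) / 10000000 * ρ - (383061 : ℝ) / 10000000 * ρ ^ 2 + (92031 : ℝ) / 10000000 * ρ ^ 3 - (10985 : ℝ) / 10000000 * ρ ^ 4 + (525 : ℝ) / 10000000 * ρ ^ 5) (s / M) / (M ^ 3 * s) else 0) s) (Kerr.radius 0 x)))) := by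
  intro M Φ x hM h2M
  have hr : 0 < Kerr.radius 0 x := lt_trans (by positivity) h2M
  have hr0 : Kerr.radius 0 x ≠ 0 := hr.ne'
  have hM0 : M ≠ 0 := hM.ne'
  -- Step 1: the bulk `K^X` (`F = 1 − 3M/s`) and the quadratic form
  have hF : HasDerivAt (fun s : ℝ ↦ 1 - 3 * M / s) (3 * M / Kerr.radius 0 x ^ 2) (Kerr.radius 0 x) := by
    refine (((hasDerivAt_const _ (3 * M)).fun_div (hasDerivAt_id' _) hr0).const_sub 1).congr_deriv ?_
    field_simp
    ring
  rw [multiplierBulk_radial_tailsCut M (fun s : ℝ ↦ 1 - 3 * M / s) Φ x hM hr hF.differentiableAt,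
    hF.deriv, inverseMetric_quadratic_decomposition_tailsCut M Φ x hM hr (weightedT_profile_lt_one hM.le h2M)]
  -- Step 2: the tails-cut profile `f = 1 − χ·2M/s` and its derivative at `r`
  have hσ : ∀ u : ℝ, HasDerivAt Real.smoothTransition (deriv Real.smoothTransition u) u := fun u ↦
    ((Real.smoothTransition.contDiff (n := 1)).differentiable one_ne_zero u).hasDerivAt
  have hχ' : HasDerivAt (fun s : ℝ ↦ Real.smoothTransition (2 - s / (8 * M)))
      (deriv Real.smoothTransition (2 - Kerr.radius 0 x / (8 * M)) * -(1 / (8 * M))) (Kerr.radius 0 x) :=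
    (hσ _).comp _ (((hasDerivAt_id' _).div_const (8 * M)).const_sub 2)
  have hf₁ : HasDerivAt (fun s : ℝ ↦ 1 - Real.smoothTransition (2 - s / (8 * M)) * (2 * M / s))
      (2 * M * Real.smoothTransition (2 - Kerr.radius 0 x / (8 * M)) / Kerr.radius 0 x ^ 2 -
        2 * M * (deriv Real.smoothTransition (2 - Kerr.radius 0 x / (8 * M)) * -(1 / (8 * M))) /
          Kerr.radius 0 x) (Kerr.radius 0 x) := by
    refine ((hχ'.fun_mul ((hasDerivAt_const _ (2 * M)).fun_div (hasDerivAt_id' _) hr0)).const_sub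
      1).congr_deriv ?_
    field_simp
    ring
  rw [hf₁.deriv]
  -- Step 3: `□ϖ₂ = r⁻² (s² f ϖ₂′)′` and the flux derivative
  have hϖ : ∀ s : ℝ, 0 < s → HasDerivAt (fun s : ℝ ↦ 2 * ((1 - 2 * M / s) * ((2 * s - 3 * M) / s ^ 2 -
      M ^ 3 * (s - 3 * M) ^ 2 / s ^ 6))) (2 * ((-2 * s ^ 6 + 14 * M * s ^ 5 - 18 * M ^ 2 * s ^ 4 +
      4 * M ^ 3 * s ^ 3 - 40 * M ^ 4 * s ^ 2 + 126 * M ^ 5 * s - 126 * M ^ 6) / s ^ 8)) s :=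
    fun s hs ↦ (hasDerivAt_morawetzWeight M s hM hs).const_mul 2
  rw [waveOperator_radial_tailsCut M (fun s ↦ 2 * ((1 - 2 * M / s) * ((2 * s - 3 * M) / s ^ 2 -
    M ^ 3 * (s - 3 * M) ^ 2 / s ^ 6))) x hM hr (by fun_prop (disch := positivity))]
  have hev : (fun s ↦ s ^ 2 * (fun s ↦ 1 - Real.smoothTransition (2 - s / (8 * M)) * (2 * M / s)) s *
      deriv (fun s : ℝ ↦ 2 * ((1 - 2 * M / s) * ((2 * s - 3 * M) / s ^ 2 - M ^ 3 * (s - 3 * M) ^ 2 / s ^ 6))) s)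
      =ᶠ[𝓝 (Kerr.radius 0 x)] fun s ↦ (1 - Real.smoothTransition (2 - s / (8 * M)) * (2 * M / s)) *
        (2 * (s ^ 2 * ((-2 * s ^ 6 + 14 * M * s ^ 5 - 18 * M ^ 2 * s ^ 4 + 4 * M ^ 3 * s ^ 3 -
          40 * M ^ 4 * s ^ 2 + 126 * M ^ 5 * s - 126 * M ^ 6) / s ^ 8))) := by
    filter_upwards [Ioi_mem_nhds hr] with s hs
    rw [(hϖ s hs).deriv]
    ring
  rw [hev.deriv_eq, (hf₁.fun_mul ((hasDerivAt_sq_mul_morawetzWeightDeriv M _ hM hr).const_mul 2)).deriv]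
  -- Step 4: the polynomial `y(ρ) = (ρ − 2)(7 − ρ)² q_θ(ρ)` behind the Hardy weight on `r < 7M`
  have hy : ∀ ρ : ℝ, HasDerivAt (fun ρ : ℝ ↦ (ρ - 2) * (7 - ρ) ^ 2 * ((-((593459 : ℝ) / 10000000)) +
      (788874 : ℝ) / 10000000 * ρ - (383061 : ℝ) / 10000000 * ρ ^ 2 + (92031 : ℝ) / 10000000 * ρ ^ 3 -
      (10985 : ℝ) / 10000000 * ρ ^ 4 + (525 : ℝ) / 10000000 * ρ ^ 5))
      ((21 : ℝ) / 50000 * ρ ^ 7 + (-((27139 : ℝ) / 2000000)) * ρ ^ 6 + (115581 : ℝ) / 625000 * ρ ^ 5 +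
        (-((688213 : ℝ) / 500000)) * ρ ^ 4 + (15080767 : ℝ) / 2500000 * ρ ^ 3 +
        (-((77595267 : ℝ) / 5000000)) * ρ ^ 2 + (5388931 : ℝ) / 250000 * ρ ^ 1 +
        (-((24601199 : ℝ) / 2000000))) ρ := by
    intro ρ
    refine ((((hasDerivAt_id' ρ).sub_const 2).fun_mul (((hasDerivAt_id' ρ).const_sub 7).fun_pow 2)).fun_mul
      ((((((hasDerivAt_const ρ _).fun_add ((hasDerivAt_id' ρ).const_mul _)).fun_sub
      ((hasDerivAt_pow 2 ρ).const_mul _)).fun_add ((hasDerivAt_pow 3 ρ).const_mul _)).fun_sub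
      ((hasDerivAt_pow 4 ρ).const_mul _)).fun_add ((hasDerivAt_pow 5 ρ).const_mul _))).congr_deriv ?_
    norm_num
    ring
  -- Step 5: cut-off value and slope on `r < 8M`, Cauchy–Schwarz for `|∇̸Φ|² ≥ 0`, nonvanishing denominators
  have hin : Kerr.radius 0 x < 8 * M → Real.smoothTransition (2 - Kerr.radius 0 x / (8 * M)) = 1 ∧
      deriv Real.smoothTransition (2 - Kerr.radius 0 x / (8 * M)) = 0 := by
    intro h8
    refine ⟨cruxCutoff_eq_one hM h8.le, ?_⟩
    have harg : 1 < 2 - Kerr.radius 0 x / (8 * M) := by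
      have : Kerr.radius 0 x / (8 * M) < 1 := (div_lt_one (by positivity)).2 h8
      linarith
    rw [Filter.EventuallyEq.deriv_eq (show Real.smoothTransition =ᶠ[𝓝 (2 - Kerr.radius 0 x / (8 * M))]
      fun _ ↦ (1 : ℝ) from by
        filter_upwards [lt_mem_nhds harg] with z hz using Real.smoothTransition.one_of_one_le hz.le),
      deriv_const]
  have hg : 0 ≤ (∑ i : Fin 3, fderiv ℝ Φ x (E4.basisVector i.succ) ^ 2) -
      ((∑ i : Fin 3, x i.succ * fderiv ℝ Φ x (E4.basisVector i.succ)) / Kerr.radius 0 x) ^ 2 := by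
    rw [sub_nonneg, div_pow, div_le_iff₀ (by positivity), Kerr.radius_zero_left, E4.spatialNorm_sq]
    simp only [Fin.sum_univ_three, Fin.succ_zero_eq_one, Fin.succ_one_eq_two, Kerr.fin_succ_two_eq_three]
    nlinarith [sq_nonneg (x 1 * fderiv ℝ Φ x (E4.basisVector 2) - x 2 * fderiv ℝ Φ x (E4.basisVector 1)),
      sq_nonneg (x 1 * fderiv ℝ Φ x (E4.basisVector 3) - x 3 * fderiv ℝ Φ x (E4.basisVector 1)),
      sq_nonneg (x 2 * fderiv ℝ Φ x (E4.basisVector 3) - x 3 * fderiv ℝ Φ x (E4.basisVector 2))]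
  have hsc : 2 * Kerr.scalarH M 0 x = 2 * M / Kerr.radius 0 x := by
    rw [hardy_scalarH_zero, mul_div_assoc]
  have hf0 : 1 - Real.smoothTransition (2 - Kerr.radius 0 x / (8 * M)) * (2 * M / Kerr.radius 0 x) ≠ 0 := by
    rw [← hsc]
    exact (sub_pos.2 (weightedT_profile_lt_one hM.le h2M)).ne'
  have h2Mχ := mul_le_of_le_one_right (by positivity : (0 : ℝ) ≤ 2 * M)
    (Real.smoothTransition.le_one (2 - Kerr.radius 0 x / (8 * M)))
  have hf1 : Kerr.radius 0 x - 2 * M * Real.smoothTransition (2 - Kerr.radius 0 x / (8 * M)) ≠ 0 :=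
    ne_of_gt (by linarith)
  have hf2 : Kerr.radius 0 x - Real.smoothTransition (2 - Kerr.radius 0 x / (8 * M)) * (2 * M) ≠ 0 :=
    ne_of_gt (by linarith)
  have hf3 : 1 - 2 * M * Real.smoothTransition (2 - Kerr.radius 0 x / (8 * M)) / Kerr.radius 0 x ≠ 0 := by
    rw [sub_ne_zero, ne_comm, ne_eq, div_eq_one_iff_eq hr0]
    exact ne_of_lt (by linarith)
  -- Step 6: assembly (the Hardy value / flux derivative on `r < 7M` and `r ≥ 7M` are supplied inline)
  rw [hsc]
  beta_reduce
  refine (morawetzBulk_master M (Kerr.radius 0 x) _ _ _ _ _ (Φ x)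
    (if Kerr.radius 0 x ≤ 7 * M then 2 * (7 * M - Kerr.radius 0 x) ^ 2 * (-(593459 / 10000000) +
      788874 / 10000000 * (Kerr.radius 0 x / M) - 383061 / 10000000 * (Kerr.radius 0 x / M) ^ 2 +
      92031 / 10000000 * (Kerr.radius 0 x / M) ^ 3 - 10985 / 10000000 * (Kerr.radius 0 x / M) ^ 4 +
      525 / 10000000 * (Kerr.radius 0 x / M) ^ 5) / (M ^ 3 * Kerr.radius 0 x) else 0)
    (deriv (fun s ↦ s ^ 2 * (1 - Real.smoothTransition (2 - s / (8 * M)) * (2 * M / s)) *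
      if s ≤ 7 * M then 2 * (7 * M - s) ^ 2 * (-(593459 / 10000000) + 788874 / 10000000 * (s / M) -
        383061 / 10000000 * (s / M) ^ 2 + 92031 / 10000000 * (s / M) ^ 3 - 10985 / 10000000 * (s / M) ^ 4 +
        525 / 10000000 * (s / M) ^ 5) / (M ^ 3 * s) else 0) (Kerr.radius 0 x))
    hM h2M (Real.smoothTransition.nonneg _) (Real.smoothTransition.le_one _)
    (Literature.NumberTheory.Sieve.GreenTao2008.deriv_smoothTransition_nonneg _)
    (Literature.NumberTheory.Sieve.GreenTao2008.deriv_smoothTransition_le_two _) hin hg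
    (fun h7 ↦ ⟨if_pos h7.le, by
      rw [← (((hy _).comp (Kerr.radius 0 x) ((hasDerivAt_id' _).div_const M)).const_mul 2).deriv]
      refine Filter.EventuallyEq.deriv_eq ?_
      filter_upwards [Ioo_mem_nhds hr h7] with s hs
      have hs0 : s ≠ 0 := hs.1.ne'
      rw [if_pos hs.2.le, cruxCutoff_eq_one hM (by linarith [hs.2]), Function.comp_apply]
      field_simp⟩)
    (fun h7 ↦ ⟨morawetzBulk_hardy_eq_zero h7 le_rfl, morawetzBulk_deriv_eq_zero fun s hs ↦ by
      rw [morawetzBulk_hardy_eq_zero h7 hs, mul_zero]⟩)).trans_eq ?_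
  -- the regrouping identity, on opaque atoms
  generalize fderiv ℝ Φ x (E4.basisVector 0) = p₀
  generalize (∑ i : Fin 3, x i.succ * fderiv ℝ Φ x (E4.basisVector i.succ)) = Y
  generalize (∑ i : Fin 3, fderiv ℝ Φ x (E4.basisVector i.succ) ^ 2) = Q
  generalize deriv Real.smoothTransition (2 - Kerr.radius 0 x / (8 * M)) = d
  generalize Real.smoothTransition (2 - Kerr.radius 0 x / (8 * M)) = χ at hf0 hf1 hf2 hf3 ⊢
  generalize Kerr.radius 0 x = r at hr0 hf0 hf1 hf2 hf3 ⊢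
  field_simp
  ring

end Summit.FinalStateConjecture.FinalStateConjecture.Theorems

end
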